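/-
Copyright (c) 2026 the pub-hodgecm-mathlib formalisation cell (harness21).  Prover seat hodgecm-mathlib-K2E5-p17 (g3) (free E5 hand on the E3 road),
Track B «K2-LIT» ∕ h413 (`stmt-HodgeConjecture-24833`), line `K2_E3_EllipticInputs`, unit U12-d, §L road «U-iso-T», brick (G⁺-b) LINE SIDE, part 5a:
ramified quadratic characters — shell ∕ ball ∕ coset evaluations and the per-coset line inversion with the Gauss sum.  2026-09-04.
-/
import Summits.HodgeConjecture.HodgeConjecture.Theorems.K2E3LocalFieldQuadraticCharSignWeight   -- ★ part 4 (p857419): `hasExponent_zero`, `norm_extend_le_one`; brings parts 1–3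
import HarnessLib

/-!
# K2_E3 road (h413), §L — (G⁺-b) line side, part 5a: the RAMIFIED quadratic character — lemmas and the per-coset identity

Cell `pub/hodgecm-mathlib` (D-0151), Track B, seat K2E5-p17 (g3) ((G⁺-b) cut with K2E5-p10 (g4)); frozen interface K2 bus 04:26:40Z, ramified places
(`γ₀ = ∫_{shell m−c} ψ χ̃` the Gauss sum, `c₀ = 0`).  `--supports stmt-HodgeConjecture-24833 --as helper`; THEOREMS ONLY.  COUNT-NEUTRAL.

For a quadratic (`χ u * χ u = 1`) RAMIFIED quasi-character `χ` of conductor exponent `c ≥ 1` (`χ̃` = `χ` extended by `0`, `n(s) = ‖s‖⁻¹`):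
* §1 the ramified shells carry no mass: `∫_{shell j} χ̃ n = 0`, `∫_{𝔭^a ∖ 𝔭^{a+i}} χ̃ n = 0`, `Z₀(1_{𝔭^N}) = 0`, `∫_{𝔭^k} χ̃ = 0` (★ Tate Gauss-sum file);
* §2 the coset values: `Z₀(1_{a+𝔭^N}) = [c ≤ N − v] χ(a) q^v μ(𝔭^N)` (★ `setIntegral_translate_mul_extend`) and the Fourier side
  `∫_{𝔭^{m−N}} χ̃(t) ψ(a t) dt = q^v χ(a) [c ≤ N − v] g`, `g = ∫_{shell m−c} ψ χ̃` (substitution `t = a⁻¹u`, ★ `integral_ball_addChar_mul_extend_cpow_of_ramified`);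
* §3 the PER-COSET identity `∫ χ̃ (1_B)^ = g · Z₀(1_B)` for every coset `B = a + 𝔭^N`.
Part 5b assembles (T1)∕(T2) for ramified `χ` and the combined `∃ γ₀ c₀` statement for every non-trivial quadratic `χ`.
[Tate1950, §2.3, §2.5] [BushnellHenniart2006, §23.5, §23.6].
HONEST LABEL: HC_CM is proved only modulo the 7 printed citations (2 remaining named inputs: hLiu418 = stmt-HodgeConjecture-24832, h413 = stmt-HodgeConjecture-24833)
until rung 0 closes; count-neutral.
-/

set_option autoImplicit false
set_option linter.dupNamespace false   -- `Summit.HodgeConjecture.HodgeConjecture.…` (D-0017 nested layout; lakefile exemption for Summits)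

noncomputable section

open MeasureTheory Measure Filter Topology Set
open scoped NNReal ENNReal Pointwise
open Literature.NumberTheory.Automorphic Literature.NumberTheory.Automorphic.LocalFieldHaar Literature.NumberTheory.Automorphic.TateDirect
open Literature.NumberTheory.GaloisRepresentations Literature.NumberTheory.GaloisRepresentations.IsNonarchimedeanLocalField
open Summit.HodgeConjecture.HodgeConjecture.Cruxes.H413.K2E3LocalFieldSignCharLineLemmas
open Summit.HodgeConjecture.HodgeConjecture.Cruxes.H413.K2E3LocalFieldSignCharZetaBalls
open Summit.HodgeConjecture.HodgeConjecture.Cruxes.H413.K2E3LocalFieldQuadraticCharLineInversion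
open Summit.HodgeConjecture.HodgeConjecture.Cruxes.H413.K2E3LocalFieldQuadraticCharSignWeight

namespace Summit.HodgeConjecture.HodgeConjecture.Cruxes.H413.K2E3LocalFieldQuadraticCharRamifiedLemmas

variable {F : Type*} [Field F] [ValuativeRel F] [TopologicalSpace F] [IsNonarchimedeanLocalField F] [MeasurableSpace F] [BorelSpace F]
  (μ : Measure F) [μ.IsAddHaarMeasure]
  (χ : QuasiChar F) (hχr : ¬ χ.IsUnramified) (hχ2 : ∀ u, χ u * χ u = 1) {c : ℕ} (hc : χ.HasConductorExp c)
  (ψ : AddChar F Circle) (hψc : Continuous ψ) {m : ℤ} (hm : ψ.HasConductorExp m)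

/-! ## §1  Ramified shells carry no mass -/

omit [MeasurableSpace F] [BorelSpace F] in
include hc in
/-- `χ` is trivial on `U^n` iff `c ≤ n` (`c` the conductor exponent). [cite: Tate1950, §2.3] -/
theorem forall_unitFiltration_iff_le (n : ℕ) : (∀ u ∈ unitFiltration F n, χ u = 1) ↔ c ≤ n := by
  constructor
  · intro h
    by_contra hn
    obtain ⟨x, hx, hx1⟩ := hc.2 n (not_le.1 hn)
    exact hx1 (h x hx)
  · exact fun h u hu => hc.1 u (unitFiltration_antitone h hu)

omit [ValuativeRel F] [IsNonarchimedeanLocalField F] [MeasurableSpace F] [BorelSpace F] in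
include hχ2 in
/-- For quadratic `χ`: `χ(u⁻¹) = χ(u)` (as complex numbers). [folklore] -/
theorem coe_apply_inv (u : Fˣ) : ((χ u⁻¹ : ℂˣ) : ℂ) = ((χ u : ℂˣ) : ℂ) := by
  rw [map_inv, Units.val_inv_eq_inv_val]
  exact inv_eq_of_mul_eq_one_left (by rw [← Units.val_mul, hχ2, Units.val_one])

include hχr in
/-- **`∫_{shell j} χ̃(s) ‖s‖⁻¹ ds = 0`** for ramified `χ`. [cite: Tate1950, §2.5] -/
theorem setIntegral_shell_extend_mul_normInv_eq_zero (j : ℤ) :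
    ∫ s in primePowBall F j \ primePowBall F (j + 1),
      Function.extend ((↑) : Fˣ → F) (fun u => ((χ u : ℂˣ) : ℂ)) 0 s * ((((normAbs F s)⁻¹ : ℝ≥0) : ℝ) : ℂ) ∂μ = 0 := by
  rw [setIntegral_congr_fun (measurableSet_shell j) (fun s hs => by rw [normInv_eq_of_mem_shell hs, mul_comm])]
  exact setIntegral_shell_mul_extend_eq_zero μ hχr j (fun _ => (residueFieldCard F : ℂ) ^ j) (fun _ _ _ => rfl)

include hχr hχ2 in
/-- `∫_{𝔭^a ∖ 𝔭^{a+i}} χ̃(s) ‖s‖⁻¹ ds = 0` for ramified quadratic `χ`. [cite: Tate1950, §2.5] -/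
theorem setIntegral_sdiff_extend_mul_normInv_eq_zero (a : ℤ) : ∀ i : ℕ,
    ∫ s in primePowBall F a \ primePowBall F (a + i),
      Function.extend ((↑) : Fˣ → F) (fun u => ((χ u : ℂˣ) : ℂ)) 0 s * ((((normAbs F s)⁻¹ : ℝ≥0) : ℝ) : ℂ) ∂μ = 0 := by
  intro i
  induction i with
  | zero => simp
  | succ i ih =>
    rw [sdiff_primePowBall_succ_eq, setIntegral_union (disjoint_sdiff_shell a i) (measurableSet_shell _)
      ((integrableOn_sign_mul_normInv μ (measurable_extend χ) (norm_extend_le_one χ hχ2) a (a + i + 1)).mono_set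
        fun t ht => ⟨ht.1, fun h => ht.2 (primePowBall_antitone (by omega) h)⟩)
      ((integrableOn_sign_mul_normInv μ (measurable_extend χ) (norm_extend_le_one χ hχ2) a (a + i + 1)).mono_set
        fun t ht => ⟨primePowBall_antitone (by omega) ht.1, ht.2⟩),
      ih, setIntegral_shell_extend_mul_normInv_eq_zero μ χ hχr (a + i), add_zero]

open scoped Classical in
include hχr hχ2 in
/-- **`Z₀(1_{𝔭^N}) = 0`** for ramified quadratic `χ`. [cite: Tate1950, §2.5] -/
theorem integral_extend_mul_normInv_mul_indicator_sub_eq_zero (N : ℤ) :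
    ∫ s, Function.extend ((↑) : Fˣ → F) (fun u => ((χ u : ℂˣ) : ℂ)) 0 s * ((((normAbs F s)⁻¹ : ℝ≥0) : ℝ) : ℂ) *
        ((primePowBall F N).indicator (fun _ => (1 : ℂ)) s - (primePowBall F 0).indicator (fun _ => (1 : ℂ)) s) ∂μ = 0 := by
  rcases le_or_gt 0 N with hN | hN
  · obtain ⟨k, rfl⟩ := Int.eq_ofNat_of_zero_le hN
    have h : (fun s => Function.extend ((↑) : Fˣ → F) (fun u => ((χ u : ℂˣ) : ℂ)) 0 s * ((((normAbs F s)⁻¹ : ℝ≥0) : ℝ) : ℂ) *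
        ((primePowBall F (k : ℤ)).indicator (fun _ => (1 : ℂ)) s - (primePowBall F 0).indicator (fun _ => (1 : ℂ)) s)) =
        fun s => -((primePowBall F 0 \ primePowBall F (k : ℤ)).indicator
          (fun s => Function.extend ((↑) : Fˣ → F) (fun u => ((χ u : ℂˣ) : ℂ)) 0 s * ((((normAbs F s)⁻¹ : ℝ≥0) : ℝ) : ℂ)) s) := by
      funext s
      by_cases h0 : s ∈ primePowBall F 0
      · by_cases hk : s ∈ primePowBall F (k : ℤ)
        · simp [h0, hk]
        · simp [h0, hk]
      · have hk : s ∉ primePowBall F (k : ℤ) := fun h => h0 (primePowBall_antitone (by omega) h)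
        simp [h0, hk]
    have h2 := setIntegral_sdiff_extend_mul_normInv_eq_zero μ χ hχr hχ2 0 k
    rw [zero_add] at h2
    rw [h, integral_neg, integral_indicator ((measurableSet_primePowBall 0).diff (measurableSet_primePowBall _)), h2, neg_zero]
  · obtain ⟨k, rfl⟩ : ∃ k : ℕ, N = -(k : ℤ) := ⟨(-N).toNat, by omega⟩
    have h : (fun s => Function.extend ((↑) : Fˣ → F) (fun u => ((χ u : ℂˣ) : ℂ)) 0 s * ((((normAbs F s)⁻¹ : ℝ≥0) : ℝ) : ℂ) *
        ((primePowBall F (-(k : ℤ))).indicator (fun _ => (1 : ℂ)) s - (primePowBall F 0).indicator (fun _ => (1 : ℂ)) s)) =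
        (primePowBall F (-(k : ℤ)) \ primePowBall F 0).indicator
          (fun s => Function.extend ((↑) : Fˣ → F) (fun u => ((χ u : ℂˣ) : ℂ)) 0 s * ((((normAbs F s)⁻¹ : ℝ≥0) : ℝ) : ℂ)) := by
      funext s
      by_cases hk : s ∈ primePowBall F (-(k : ℤ))
      · by_cases h0 : s ∈ primePowBall F 0
        · simp [h0, hk]
        · simp [h0, hk]
      · have h0 : s ∉ primePowBall F 0 := fun h => hk (primePowBall_antitone (by omega) h)
        simp [h0, hk]
    have h2 := setIntegral_sdiff_extend_mul_normInv_eq_zero μ χ hχr hχ2 (-(k : ℤ)) k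
    rw [neg_add_cancel] at h2
    rw [h, integral_indicator ((measurableSet_primePowBall _).diff (measurableSet_primePowBall 0)), h2]

include hχr hχ2 in
/-- **`∫_{𝔭^k} χ̃ = 0`** for ramified quadratic `χ` (★ Tate, weight `‖·‖^0`). [cite: Tate1950, §2.5] -/
theorem setIntegral_primePowBall_extend_eq_zero (k : ℤ) :
    ∫ s in primePowBall F k, Function.extend ((↑) : Fˣ → F) (fun u => ((χ u : ℂˣ) : ℂ)) 0 s ∂μ = 0 := by
  haveI : T2Space F := (isLocalField F).toT2Space
  have h := integral_ball_extend_cpow_eq_zero μ hχr (hasExponent_zero χ hχ2) 0 (by norm_num) k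
  rw [setIntegral_eq_of_subset_of_forall_sdiff_eq_zero (s := primePowBall F k \ {(0 : F)}) (measurableSet_primePowBall k)
    Set.sdiff_subset (fun x hx => ?_)]
  · rw [← h]
    refine setIntegral_congr_fun ((measurableSet_primePowBall k).diff (measurableSet_singleton 0)) fun x _ => ?_
    rw [Complex.cpow_zero, mul_one]
  · have hx0 : x = 0 := by
      by_contra h0
      exact hx.2 ⟨hx.1, fun h1 => h0 h1⟩
    rw [hx0, extend_apply_zero]

/-! ## §2  Coset values -/

open scoped Classical in
include hc in
/-- **`Z₀(1_{a+𝔭^N}) = [c ≤ N − v] · χ(a) q^v μ(𝔭^N)`** for `‖a‖ = (q⁻¹)^v`, `v < N` (the coset is `a·U^{N−v}`, on which `χ̃` is the constant `χ(a)` iff `c ≤ N − v`, and has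
mean zero otherwise — ★ `setIntegral_translate_mul_extend`). [cite: Tate1950, §2.5] [cite: BushnellHenniart2006, §23.6] -/
theorem integral_extend_mul_normInv_mul_indicator_vadd {a : F} {v N : ℤ} (ha : normAbs F a = ((residueFieldCard F : ℝ≥0)⁻¹) ^ v)
    (hvN : v < N) (ha0 : a ≠ 0) :
    ∫ s, Function.extend ((↑) : Fˣ → F) (fun u => ((χ u : ℂˣ) : ℂ)) 0 s * ((((normAbs F s)⁻¹ : ℝ≥0) : ℝ) : ℂ) *
        ((a +ᵥ primePowBall F N).indicator (fun _ => (1 : ℂ)) s -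
          (primePowBall F 0).indicator (fun _ => (a +ᵥ primePowBall F N).indicator (fun _ => (1 : ℂ)) 0) s) ∂μ =
      if (c : ℤ) ≤ N - v then ((χ (Units.mk0 a ha0) : ℂˣ) : ℂ) * (residueFieldCard F : ℂ) ^ v * (μ.real (primePowBall F N) : ℂ) else 0 := by
  have ha' : a ∉ primePowBall F N := fun h => by have := (mem_primePowBall_iff_le ha N).1 h; omega
  have h0B : (0 : F) ∉ a +ᵥ primePowBall F N := fun h => by
    rw [mem_vadd_primePowBall_iff, zero_sub] at h
    exact ha' (by simpa using neg_mem_primePowBall h)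
  have hshell : ∀ s ∈ a +ᵥ primePowBall F N, s ∈ primePowBall F v \ primePowBall F (v + 1) := fun s hs => by
    rw [mem_shell_iff, normAbs_eq_of_sub_mem ha' ((mem_vadd_primePowBall_iff).1 hs), ha]
  have hset : (a +ᵥ primePowBall F N) = {x | x - a ∈ primePowBall F N} := by
    ext x; exact mem_vadd_primePowBall_iff
  -- reduce to the set integral of `n · χ̃` over the coset
  have h1 : (fun s => Function.extend ((↑) : Fˣ → F) (fun u => ((χ u : ℂˣ) : ℂ)) 0 s * ((((normAbs F s)⁻¹ : ℝ≥0) : ℝ) : ℂ) *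
        ((a +ᵥ primePowBall F N).indicator (fun _ => (1 : ℂ)) s -
          (primePowBall F 0).indicator (fun _ => (a +ᵥ primePowBall F N).indicator (fun _ => (1 : ℂ)) 0) s)) =
        (a +ᵥ primePowBall F N).indicator (fun s => ((((normAbs F s)⁻¹ : ℝ≥0) : ℝ) : ℂ) *
          Function.extend ((↑) : Fˣ → F) (fun u => ((χ u : ℂˣ) : ℂ)) 0 s) := by
    funext s
    have h0 : (a +ᵥ primePowBall F N).indicator (fun _ => (1 : ℂ)) 0 = 0 := by simp [h0B]
    have h0' : (primePowBall F 0).indicator (fun _ => (a +ᵥ primePowBall F N).indicator (fun _ => (1 : ℂ)) 0) s = 0 := by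
      rw [h0]; exact Set.indicator_apply_eq_zero.2 fun _ => rfl
    rw [h0', sub_zero]
    by_cases hs : s ∈ a +ᵥ primePowBall F N
    · rw [Set.indicator_of_mem hs, Set.indicator_of_mem hs, mul_one, mul_comm]
    · simp [hs]
  rw [h1, integral_indicator (measurableSet_vadd_primePowBall N a), hset,
    setIntegral_translate_mul_extend μ ha' ha ha0 _ (fun u hu x => by rw [map_mul, hu, one_mul]),
    forall_unitFiltration_iff_le χ hc, ← hset]
  have hNv : ((N - v).toNat : ℤ) = N - v := Int.toNat_of_nonneg (by omega)
  have hval : ∫ x in a +ᵥ primePowBall F N, ((((normAbs F x)⁻¹ : ℝ≥0) : ℝ) : ℂ) ∂μ = (residueFieldCard F : ℂ) ^ v * (μ.real (primePowBall F N) : ℂ) := by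
    rw [setIntegral_congr_fun (measurableSet_vadd_primePowBall N a) (fun s hs => normInv_eq_of_mem_shell (hshell s hs)),
      setIntegral_const, Complex.real_smul, show μ.real (a +ᵥ primePowBall F N) = μ.real (primePowBall F N) by
        simp only [Measure.real, measure_vadd], mul_comm]
  by_cases hcN : (c : ℤ) ≤ N - v
  · rw [if_pos (by omega), if_pos hcN, hval, mul_assoc]
  · rw [if_neg (by omega), if_neg hcN]

include hχr hχ2 hm in
/-- Fourier side, the ball through `0`: `∫_{𝔭^{m−N}} χ̃(t) ψ(a t) dt = 0` for `a ∈ 𝔭^N` (the phase is `1`, the ramified ball integral vanishes). [cite: Tate1950, §2.5] -/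
theorem setIntegral_primePowBall_extend_mul_addChar_of_mem {a : F} {N : ℤ} (ha : a ∈ primePowBall F N) :
    ∫ t in primePowBall F (m - N), Function.extend ((↑) : Fˣ → F) (fun u => ((χ u : ℂˣ) : ℂ)) 0 t * ((ψ (a * t) : Circle) : ℂ) ∂μ = 0 := by
  rw [← setIntegral_primePowBall_extend_eq_zero μ χ hχr hχ2 (m - N)]
  refine setIntegral_congr_fun (measurableSet_primePowBall _) fun t ht => ?_
  have hat : a * t ∈ primePowBall F m := by
    have := mul_mem_primePowBall ha ht
    rwa [add_sub_cancel] at this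
  rw [hm.1 _ hat, Circle.coe_one, mul_one]

include hχr hχ2 hc hψc hm in
/-- **Fourier side, coset off `0`**: for `‖a‖ = (q⁻¹)^v`, `a ≠ 0`,
`∫_{𝔭^{m−N}} χ̃(t) ψ(a t) dt = q^v · χ(a) · [c ≤ N − v] · g`, `g = ∫_{shell m−c} ψ χ̃` (substitute `t = a⁻¹u`, then ★ Tate's ramified ball evaluation).
[cite: Tate1950, §2.5] [cite: BushnellHenniart2006, §23.6] -/
theorem setIntegral_primePowBall_extend_mul_addChar {a : F} {v : ℤ} (ha : normAbs F a = ((residueFieldCard F : ℝ≥0)⁻¹) ^ v) (ha0 : a ≠ 0) (N : ℤ) :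
    ∫ t in primePowBall F (m - N), Function.extend ((↑) : Fˣ → F) (fun u => ((χ u : ℂˣ) : ℂ)) 0 t * ((ψ (a * t) : Circle) : ℂ) ∂μ =
      (residueFieldCard F : ℂ) ^ v * ((χ (Units.mk0 a ha0) : ℂˣ) : ℂ) *
        (if (c : ℤ) ≤ N - v then
          ∫ x in primePowBall F (m - c) \ primePowBall F (m - c + 1),
            (ψ x : ℂ) * Function.extend ((↑) : Fˣ → F) (fun u => ((χ u : ℂˣ) : ℂ)) 0 x ∂μ
         else 0) := by
  haveI : T2Space F := (isLocalField F).toT2Space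
  have hc1 : 1 ≤ c := one_le_of_hasConductorExp_of_not_isUnramified hχr hc
  have hq : (residueFieldCard F : ℝ≥0) ≠ 0 := Nat.cast_ne_zero.2 (residueFieldCard_ne_zero F)
  have hainv : normAbs F a⁻¹ = ((residueFieldCard F : ℝ≥0)⁻¹) ^ (-v) := by rw [map_inv₀, ha, zpow_neg]
  -- Tate's ramified ball evaluation at weight `0`
  have hT := integral_ball_addChar_mul_extend_cpow_of_ramified μ hψc hm hc hc1 (hasExponent_zero χ hχ2) 0 (by norm_num) (N - v)
  have hT' : ∫ x in primePowBall F (m - (N - v)), (ψ x : ℂ) * Function.extend ((↑) : Fˣ → F) (fun u => ((χ u : ℂˣ) : ℂ)) 0 x ∂μ =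
      if (c : ℤ) ≤ N - v then
        ∫ x in primePowBall F (m - c) \ primePowBall F (m - c + 1), (ψ x : ℂ) * Function.extend ((↑) : Fˣ → F) (fun u => ((χ u : ℂˣ) : ℂ)) 0 x ∂μ
      else 0 := by
    rw [setIntegral_eq_of_subset_of_forall_sdiff_eq_zero (s := primePowBall F (m - (N - v)) \ {(0 : F)}) (measurableSet_primePowBall _)
      Set.sdiff_subset (fun x hx => by
      have hx0 : x = 0 := by
        by_contra h0
        exact hx.2 ⟨hx.1, fun h1 => h0 h1⟩
      rw [hx0, extend_apply_zero, mul_zero])]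
    rw [setIntegral_congr_fun ((measurableSet_primePowBall _).diff (measurableSet_singleton 0)) (fun x _ => by
      rw [Complex.cpow_zero, mul_one])] at hT
    rw [hT]
    split_ifs
    · rw [mul_zero, Complex.cpow_zero, one_mul]
    · rfl
  -- the substitution `t = a⁻¹ u`
  have hsub := integral_comp_mul_left μ (inv_ne_zero ha0)
    ((primePowBall F (m - N)).indicator fun t => Function.extend ((↑) : Fˣ → F) (fun u => ((χ u : ℂˣ) : ℂ)) 0 t * ((ψ (a * t) : Circle) : ℂ))
  rw [inv_inv, ha] at hsub
  have hpt : ∀ u : F, (primePowBall F (m - N)).indicator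
      (fun t => Function.extend ((↑) : Fˣ → F) (fun u => ((χ u : ℂˣ) : ℂ)) 0 t * ((ψ (a * t) : Circle) : ℂ)) (a⁻¹ * u) =
      (primePowBall F (m - (N - v))).indicator
        (fun x => ((χ (Units.mk0 a ha0) : ℂˣ) : ℂ) * ((ψ x : ℂ) * Function.extend ((↑) : Fˣ → F) (fun u => ((χ u : ℂˣ) : ℂ)) 0 x)) u := by
    intro u
    have hmem : a⁻¹ * u ∈ primePowBall F (m - N) ↔ u ∈ primePowBall F (m - (N - v)) := by
      rw [mul_mem_primePowBall_iff hainv, show m - N - -v = m - (N - v) by ring]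
    by_cases hu : u ∈ primePowBall F (m - (N - v))
    · rw [Set.indicator_of_mem (hmem.2 hu), Set.indicator_of_mem hu, mul_inv_cancel_left₀ ha0,
        show a⁻¹ * u = (((Units.mk0 a ha0)⁻¹ : Fˣ) : F) * u by rw [Units.val_inv_eq_inv_val, Units.val_mk0],
        extend_coe_mul, coe_apply_inv χ hχ2]
      ring
    · rw [Set.indicator_of_notMem (fun h => hu (hmem.1 h)), Set.indicator_of_notMem hu]
  simp_rw [hpt] at hsub
  rw [integral_indicator (measurableSet_primePowBall _), integral_indicator (measurableSet_primePowBall _), integral_const_mul, hT'] at hsub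
  -- `hsub : χ(a) * (if …) = ‖a‖ • ∫_{𝔭^{m−N}} χ̃ ψ(a·)`; invert the scalar `‖a‖ = (q⁻¹)^v`
  have hsc : ((((residueFieldCard F : ℝ≥0)⁻¹ ^ v : ℝ≥0) : ℝ) : ℂ) * (residueFieldCard F : ℂ) ^ v = 1 := by
    push_cast
    rw [inv_zpow, inv_mul_cancel₀ (zpow_ne_zero v (Nat.cast_ne_zero.2 (residueFieldCard_ne_zero F)))]
  rw [Complex.real_smul] at hsub
  calc ∫ t in primePowBall F (m - N), Function.extend ((↑) : Fˣ → F) (fun u => ((χ u : ℂˣ) : ℂ)) 0 t * ((ψ (a * t) : Circle) : ℂ) ∂μ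
      = (((((residueFieldCard F : ℝ≥0)⁻¹ ^ v : ℝ≥0) : ℝ) : ℂ) * (residueFieldCard F : ℂ) ^ v) *
          ∫ t in primePowBall F (m - N), Function.extend ((↑) : Fˣ → F) (fun u => ((χ u : ℂˣ) : ℂ)) 0 t * ((ψ (a * t) : Circle) : ℂ) ∂μ := by
        rw [hsc, one_mul]
    _ = (residueFieldCard F : ℂ) ^ v * ((((((residueFieldCard F : ℝ≥0)⁻¹ ^ v : ℝ≥0) : ℝ) : ℂ)) *
          ∫ t in primePowBall F (m - N), Function.extend ((↑) : Fˣ → F) (fun u => ((χ u : ℂˣ) : ℂ)) 0 t * ((ψ (a * t) : Circle) : ℂ) ∂μ) := by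
        ring
    _ = (residueFieldCard F : ℂ) ^ v * (((χ (Units.mk0 a ha0) : ℂˣ) : ℂ) *
        (if (c : ℤ) ≤ N - v then
          ∫ x in primePowBall F (m - c) \ primePowBall F (m - c + 1),
            (ψ x : ℂ) * Function.extend ((↑) : Fˣ → F) (fun u => ((χ u : ℂˣ) : ℂ)) 0 x ∂μ
         else 0)) := by rw [← hsub]
    _ = _ := by ring

/-! ## §3  The per-coset identity, ramified case -/

open scoped Classical in
include hχr hχ2 hc hψc hm in
/-- **Per-coset line inversion, ramified quadratic `χ`**: for `B = a + 𝔭^N`, `∫ χ̃ (1_B)^ dμ = g · Z₀(1_B)` with `g = ∫_{shell m−c} ψ χ̃` (no `δ₀` term).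
[cite: Tate1950, §2.5] [cite: BushnellHenniart2006, §23.6] -/
theorem integral_extend_mul_fourierSB_indicator_vadd_eq (a : F) (N : ℤ) :
    ∫ t, Function.extend ((↑) : Fˣ → F) (fun u => ((χ u : ℂˣ) : ℂ)) 0 t * fourierSB ψ μ ((a +ᵥ primePowBall F N).indicator fun _ => (1 : ℂ)) t ∂μ =
      (∫ x in primePowBall F (m - c) \ primePowBall F (m - c + 1),
          (ψ x : ℂ) * Function.extend ((↑) : Fˣ → F) (fun u => ((χ u : ℂˣ) : ℂ)) 0 x ∂μ) *
        ∫ s, Function.extend ((↑) : Fˣ → F) (fun u => ((χ u : ℂˣ) : ℂ)) 0 s * ((((normAbs F s)⁻¹ : ℝ≥0) : ℝ) : ℂ) *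
          ((a +ᵥ primePowBall F N).indicator (fun _ => (1 : ℂ)) s -
            (primePowBall F 0).indicator (fun _ => (a +ᵥ primePowBall F N).indicator (fun _ => (1 : ℂ)) 0) s) ∂μ := by
  by_cases ha : a ∈ primePowBall F N
  · rw [integral_sign_mul_fourierSB_indicator_vadd μ ψ hm a N, setIntegral_primePowBall_extend_mul_addChar_of_mem μ χ hχr hχ2 ψ hm ha,
      mul_zero, vadd_primePowBall_eq_self ha, Set.indicator_of_mem (zero_mem_primePowBall N),
      integral_extend_mul_normInv_mul_indicator_sub_eq_zero μ χ hχr hχ2 N, mul_zero]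
  · have ha0 : a ≠ 0 := fun h => ha (h ▸ zero_mem_primePowBall N)
    obtain ⟨v, hv⟩ := exists_normAbs_eq_inv_zpow ha0
    have hvN : v < N := by
      by_contra h
      exact ha ((mem_primePowBall_iff_le hv N).2 (not_lt.1 h))
    rw [integral_sign_mul_fourierSB_indicator_vadd μ ψ hm a N, setIntegral_primePowBall_extend_mul_addChar μ χ hχr hχ2 hc ψ hψc hm hv ha0 N,
      integral_extend_mul_normInv_mul_indicator_vadd μ χ hc hv hvN ha0]
    split_ifs <;> ring

end Summit.HodgeConjecture.HodgeConjecture.Cruxes.H413.K2E3LocalFieldQuadraticCharRamifiedLemmas
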